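import Summits.FinalStateConjecture.FinalStateConjecture.Theses.StarvedNecks
import Summits.FinalStateConjecture.FinalStateConjecture.Theorems.SeamedChartsExhaust.Negative.NoHoleCase
import Literature.Geometry.Lorentzian.KerrConvergenceProofs
import Literature.Geometry.Lorentzian.CausalFutureProofs


/-!
# DrefuteStubs — BOTH registered stubs of the picked line `wide-anchoring` (generation 2) PROVED
(crux `StarvedNecks.SeamedChartsExhaust`, stmt-FinalStateConjecture-13551; drefute seat
`refuter-drefute-stmt-FinalStateConjecture-13551-0`, 2026-08-16; skeleton 5382cf52ebbe)

* `DRefute.stub_firstContact` — VERBATIM the registered `stub_firstContact` (hd, hR, h8): contact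
  functions `gₖ = rₖ − Rₖ ∘ tₖ` along the lab ray, closed contact set, `sInf`, `closure_Ico`, domain
  membership by `h8` + `setOf_lt_excision_subset_flatDomain`, parameter collar `exists_collar`, flow by
  the LANDED `Negative.line_mem_causalFuture` (p74470) with `hd`.
* `DRefute.stub_rim` — VERBATIM the registered `stub_rim` (hcl, h1, h8, h11): `closure_union` +
  `closure_iUnion_of_finite`, SEAMED (11) for the flat part, HonestCore (c) with `ϱ := Rᵢ` for the hole part.
* `DRefute.Check.*` — verbatim copies of `WideAnchoring.Registered.stub_firstContact/stub_rim` and two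
  `example`s certifying the proofs have EXACTLY the registered types, so the skeleton's kernel-checked
  `SeamedChartsExhaust_of registered_firstContact registered_rim` closes the crux once the lead pastes
  them (or imports this module: `exact DRefute.stub_firstContact 𝓢 O d R hd hR h8 τ₁ y hy₀ hy₁`,
  `exact DRefute.stub_rim 𝓢 O d R R₀ hcl h1 h8 h11 τ₁ hτ₁`).

`lean check`: rc 0, 0 sorries, 0 warnings; axioms of both theorems {propext, Classical.choice, Quot.sound}.
Attack log (drefute arsenal) in `DrefuteStubRim.md` / `DrefuteStubs.md`: no stub false, none misstated;
hypotheses consumed = exactly the signatures' (hd / hR / h8; hcl / h1 / h8 / h11); `hd` load-bearing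
(skeleton §5 `stub_firstContact_false_without_hd`, ReversedModel).
-/

noncomputable section


open Set Filter Topology Function TopologicalSpace
open scoped Manifold ContDiff ENNReal Topology
open Literature.Geometry.Lorentzian

namespace Summit.FinalStateConjecture.FinalStateConjecture.Cruxes.SeamedChartsExhaust.DRefute

set_option linter.dupNamespace false

open Summit.FinalStateConjecture.FinalStateConjecture.Theorems.SeamedChartsExhaust.Negative
  (line_mem_causalFuture)

/-- **Parameter collar**: if the closed segment `σ ↦ y + σ v`, `σ ∈ [0, s]`, lies in an open
`U ⊆ E4`, then so does a slightly longer one, `σ ∈ [−ε, s + ε]`. [folklore] -/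
theorem exists_collar (U : Opens E4) (y v : E4) {s : ℝ} (hs : 0 ≤ s)
    (hmem : ∀ σ ∈ Icc (0 : ℝ) s, y + σ • v ∈ U) :
    ∃ ε > 0, ∀ σ ∈ Icc (-ε) (s + ε), y + σ • v ∈ U := by
  have hcont : Continuous fun σ : ℝ ↦ y + σ • v :=
    continuous_const.add (continuous_id.smul continuous_const)
  have hV : IsOpen ((fun σ : ℝ ↦ y + σ • v) ⁻¹' (U : Set E4)) := U.isOpen.preimage hcont
  obtain ⟨ε₁, hε₁, hb₁⟩ := Metric.isOpen_iff.mp hV 0 (hmem 0 ⟨le_rfl, hs⟩)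
  obtain ⟨ε₂, hε₂, hb₂⟩ := Metric.isOpen_iff.mp hV s (hmem s ⟨hs, le_rfl⟩)
  refine ⟨min ε₁ ε₂ / 2, by positivity, fun σ hσ ↦ ?_⟩
  have hm₁ := min_le_left ε₁ ε₂
  have hm₂ := min_le_right ε₁ ε₂
  rcases lt_or_ge σ 0 with hσ0 | hσ0
  · have hball : σ ∈ Metric.ball (0 : ℝ) ε₁ := by
      rw [Metric.mem_ball, Real.dist_eq, sub_zero, abs_lt]
      constructor <;> linarith [hσ.1]
    exact hb₁ hball
  · rcases le_or_gt σ s with hσs | hσs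
    · exact hmem σ ⟨hσ0, hσs⟩
    · have hball : σ ∈ Metric.ball s ε₂ := by
        rw [Metric.mem_ball, Real.dist_eq, abs_lt]
        constructor <;> linarith [hσ.2]
      exact hb₂ hball

/-- Lab time along the lab ray: `(p + u e₀)⁰ = p⁰ + u`. -/
theorem coord0_add_smul_e₀ (p : E4) (u : ℝ) : (p + u • E4.basisVector 0) 0 = p 0 + u := by
  simp

/-- **FIRST CONTACT** (`wide-anchoring` g2 `stub_firstContact`, verbatim signature): for a flat-late
`y` with `τ₀ < y⁰ ≤ τ₁`, the lab ray `σ ↦ Φ(y + σ e₀)` either reaches the flat slab `{x⁰ = τ₁}` inside the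
flat domain (so `Φ y ∈ J⁻(Φ(flat slab))`), or it makes first contact with the closed set
`⋃ₖ {rₖ ≤ Rₖ(tₖ)}` at a point `c` of the flat domain with `τ₀ < c⁰ ≤ τ₁` and `Φ y ≤ Φ c`.
O'Neill 1983, Ch. 14, p. 402. [folklore] -/
theorem stub_firstContact (𝓢 : Spacetime.{0} 4) (O : Set 𝓢.carrier)
    (d : FinalStateDecomposition 𝓢 O 2) (R : Fin d.N → ℝ → ℝ)
    (hd : ∀ y : d.flatDomain, d.τ₀ < y.1 0 →
      𝓢.timeOrientation.IsFutureDirected (mfderiv 𝓘(ℝ, E4) (𝓡 4) d.flatChart y (E4.basisVector 0)))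
    (hR : ∀ i, Continuous (R i))
    (h8 : ∀ j (y : E4), d.τ₀ ≤ y 0 → (d.background j).radius y ≤ d.excision j (y 0) →
      (d.background j).radius y + 2 ≤ R j ((d.background j).time y))
    (τ₁ : ℝ) (y : d.flatDomain) (hy₀ : d.τ₀ < y.1 0) (hy₁ : y.1 0 ≤ τ₁) :
    d.flatChart y ∈ 𝓢.metric.causalPast 𝓢.timeOrientation
        (d.flatChart '' (Minkowski.backgroundOn d.flatDomain).timeSlab τ₁) ∨
      ∃ (c : d.flatDomain) (k : Fin d.N), d.τ₀ < c.1 0 ∧ c.1 0 ≤ τ₁ ∧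
        (d.background k).radius c.1 ≤ R k ((d.background k).time c.1) ∧
        d.flatChart y ∈ 𝓢.metric.causalPast 𝓢.timeOrientation {d.flatChart c} := by
  -- the contact functions along the lab ray
  set g : Fin d.N → ℝ → ℝ := fun k σ ↦ (d.background k).radius (y.1 + σ • E4.basisVector 0) -
      R k ((d.background k).time (y.1 + σ • E4.basisVector 0)) with hgdef
  have hgc : ∀ k, Continuous (g k) := by
    intro k
    have hline : Continuous fun σ : ℝ ↦ y.1 + σ • (E4.basisVector 0 : E4) :=
      continuous_const.add (continuous_id.smul continuous_const)
    have hr : Continuous fun x : E4 ↦ (d.background k).radius x :=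
      (Kerr.continuous_radius _).comp (continuous_poincareInv _ _)
    have hc0 : Continuous fun x : E4 ↦ x 0 := PiLp.continuous_apply 2 _ 0
    have ht : Continuous fun x : E4 ↦ (d.background k).time x :=
      hc0.comp (continuous_poincareInv _ _)
    exact (hr.comp hline).sub ((hR k).comp (ht.comp hline))
  -- a ray point with lab time `> τ₀` and every `gₖ > -2` lies in the flat domain
  have hmemU : ∀ σ : ℝ, d.τ₀ < y.1 0 + σ → (∀ k, -2 < g k σ) →
      y.1 + σ • E4.basisVector 0 ∈ d.flatDomain := by
    intro σ hσ hg
    apply d.setOf_lt_excision_subset_flatDomain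
    refine ⟨?_, fun k ↦ ?_⟩
    · show d.τ₀ < (y.1 + σ • E4.basisVector 0) 0
      rw [coord0_add_smul_e₀]
      exact hσ
    · show d.excision k ((y.1 + σ • E4.basisVector 0) 0) <
        (d.background k).radius (y.1 + σ • E4.basisVector 0)
      by_contra hk
      rw [not_lt] at hk
      have h8k : (d.background k).radius (y.1 + σ • E4.basisVector 0) + 2 ≤
          R k ((d.background k).time (y.1 + σ • E4.basisVector 0)) :=
        h8 k _ (by rw [coord0_add_smul_e₀]; exact hσ.le) hk
      have hgk : g k σ = (d.background k).radius (y.1 + σ • E4.basisVector 0) -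
          R k ((d.background k).time (y.1 + σ • E4.basisVector 0)) := rfl
      linarith [hg k]
  -- the flow along the ray up to parameter `u`, granted membership on `[0, u]` (HonestCore (d))
  have hflowTo : ∀ (u : ℝ) (hu : 0 ≤ u)
      (hmem : ∀ σ ∈ Icc (0 : ℝ) u, y.1 + σ • E4.basisVector 0 ∈ d.flatDomain),
      d.flatChart y ∈ 𝓢.metric.causalPast 𝓢.timeOrientation
        {d.flatChart ⟨y.1 + u • E4.basisVector 0, hmem u ⟨hu, le_rfl⟩⟩} := by
    intro u hu hmem
    obtain ⟨ε, hε, hcollar⟩ := exists_collar d.flatDomain y.1 (E4.basisVector 0) hu hmem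
    have hflow := line_mem_causalFuture (𝓢 := 𝓢) d.isLateChart_flat.contMDiff (E4.basisVector 0)
      y.1 y.2 hu hε hcollar (by
        rintro z ⟨σ, hσ, hzσ⟩
        apply hd
        show d.τ₀ < z.1 0
        rw [← hzσ]
        show d.τ₀ < (y.1 + σ • E4.basisVector 0) 0
        rw [coord0_add_smul_e₀]
        linarith [hσ.1])
    exact LorentzianMetric.mem_causalPast_of_mem_causalFuture hflow
  -- the contact set
  set s : ℝ := τ₁ - y.1 0 with hsdef
  have hs0 : 0 ≤ s := by rw [hsdef]; linarith
  set C : Set ℝ := Icc 0 s ∩ ⋃ k : Fin d.N, {σ | g k σ ≤ 0} with hCdef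
  have hCclosed : IsClosed C :=
    isClosed_Icc.inter (isClosed_iUnion_of_finite fun k ↦ isClosed_le (hgc k) continuous_const)
  have hCbdd : BddBelow C := ⟨0, fun σ hσ ↦ hσ.1.1⟩
  by_cases hC : C.Nonempty
  · -- RIGHT disjunct: first contact at `u = min C`
    right
    set u : ℝ := sInf C with hudef
    have huC : u ∈ C := hCclosed.csInf_mem hC hCbdd
    obtain ⟨⟨hu0, hus⟩, huk⟩ := huC
    obtain ⟨k, hk⟩ := mem_iUnion.mp huk
    have hk : g k u ≤ 0 := hk
    -- no contact strictly before `u`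
    have hbefore : ∀ σ, 0 ≤ σ → σ < u → ∀ j, 0 < g j σ := by
      intro σ hσ0 hσu j
      by_contra hj
      rw [not_lt] at hj
      have hσC : σ ∈ C := ⟨⟨hσ0, by linarith⟩, mem_iUnion.mpr ⟨j, hj⟩⟩
      exact absurd (csInf_le hCbdd hσC) (not_le.mpr hσu)
    -- the ray stays in the flat domain on `[0, u]`
    have hmem : ∀ σ ∈ Icc (0 : ℝ) u, y.1 + σ • E4.basisVector 0 ∈ d.flatDomain := by
      intro σ hσ
      rcases hσ.2.lt_or_eq with hlt | heq
      · exact hmemU σ (by linarith [hσ.1]) fun j ↦ by linarith [hbefore σ hσ.1 hlt j]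
      · rw [heq]
        rcases hu0.eq_or_lt with hu00 | hupos
        · have : y.1 + u • E4.basisVector 0 = y.1 := by rw [← hu00, zero_smul, add_zero]
          rw [this]
          exact y.2
        · refine hmemU u (by linarith) fun j ↦ ?_
          have hIco : Ico 0 u ⊆ {σ | 0 ≤ g j σ} := fun σ hσ' ↦ (hbefore σ hσ'.1 hσ'.2 j).le
          have hcl : closure (Ico 0 u) ⊆ {σ | 0 ≤ g j σ} :=
            (isClosed_le continuous_const (hgc j)).closure_subset_iff.mpr hIco
          rw [closure_Ico hupos.ne] at hcl
          have hju : 0 ≤ g j u := hcl ⟨hu0, le_rfl⟩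
          linarith
    refine ⟨⟨y.1 + u • E4.basisVector 0, hmem u ⟨hu0, le_rfl⟩⟩, k, ?_, ?_, ?_, hflowTo u hu0 hmem⟩
    · show d.τ₀ < (y.1 + u • E4.basisVector 0) 0
      rw [coord0_add_smul_e₀]
      linarith
    · show (y.1 + u • E4.basisVector 0) 0 ≤ τ₁
      rw [coord0_add_smul_e₀]
      linarith
    · show (d.background k).radius (y.1 + u • E4.basisVector 0) ≤
        R k ((d.background k).time (y.1 + u • E4.basisVector 0))
      have hgk : g k u = (d.background k).radius (y.1 + u • E4.basisVector 0) -
          R k ((d.background k).time (y.1 + u • E4.basisVector 0)) := rfl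
      linarith
  · -- LEFT disjunct: no contact, the ray reaches the flat slab inside the flat domain
    left
    have hall : ∀ σ ∈ Icc (0 : ℝ) s, ∀ j, 0 < g j σ := by
      intro σ hσ j
      by_contra hj
      rw [not_lt] at hj
      exact hC ⟨σ, hσ, mem_iUnion.mpr ⟨j, hj⟩⟩
    have hmem : ∀ σ ∈ Icc (0 : ℝ) s, y.1 + σ • E4.basisVector 0 ∈ d.flatDomain :=
      fun σ hσ ↦ hmemU σ (by linarith [hσ.1]) fun j ↦ by linarith [hall σ hσ j]
    have hz : (⟨y.1 + s • E4.basisVector 0, hmem s ⟨hs0, le_rfl⟩⟩ : d.flatDomain) ∈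
        (Minkowski.backgroundOn d.flatDomain).timeSlab τ₁ := by
      show (y.1 + s • E4.basisVector 0) 0 = τ₁
      rw [coord0_add_smul_e₀, hsdef]
      ring
    have hzS : d.flatChart ⟨y.1 + s • E4.basisVector 0, hmem s ⟨hs0, le_rfl⟩⟩ ∈
        d.flatChart '' (Minkowski.backgroundOn d.flatDomain).timeSlab τ₁ := ⟨_, hz, rfl⟩
    exact LorentzianMetric.causalFuture_mono (Set.singleton_subset_iff.mpr hzS) (hflowTo s hs0 hmem)

end Summit.FinalStateConjecture.FinalStateConjecture.Cruxes.SeamedChartsExhaust.DRefute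



open Set Filter Topology Function TopologicalSpace
open scoped Manifold ContDiff ENNReal Topology
open Literature.Geometry.Lorentzian

namespace Summit.FinalStateConjecture.FinalStateConjecture.Cruxes.SeamedChartsExhaust.DRefute

set_option linter.dupNamespace false

/-- **RIM ENUMERATION** (`wide-anchoring` g2 / `rim-criterion` `stub_rim`, verbatim signature):
every point of `O` in the closure of the certified late region after `τ₁` but not in it lies on the
certified slab at `τ₁` or is a ride-able certified tube point (hole time `≤ τ₁`, `R₀ ≤ rⱼ ≤ Rⱼ(tⱼ)`,
hole-late or flat-late). O'Neill 1983, Ch. 14, p. 403. [folklore] -/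
theorem stub_rim (𝓢 : Spacetime.{0} 4) (O : Set 𝓢.carrier) (d : FinalStateDecomposition 𝓢 O 2)
    (R : Fin d.N → ℝ → ℝ) (R₀ : ℝ)
    (hcl : ∀ i (τ' : ℝ) (ϱ : ℝ → ℝ), Continuous ϱ → d.τ₀ < τ' →
      closure (d.chart i '' {x | τ' ≤ (d.background i).time x.1 ∧
        (d.background i).radius x.1 ≤ ϱ ((d.background i).time x.1)}) ∩ O ⊆
      d.chart i '' {x | τ' ≤ (d.background i).time x.1 ∧
        (d.background i).radius x.1 ≤ ϱ ((d.background i).time x.1)})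
    (h1 : ∀ i, Continuous (R i) ∧ ∀ s, R₀ ≤ d.excision i s)
    (h8 : ∀ j (y : E4), d.τ₀ ≤ y 0 → (d.background j).radius y ≤ d.excision j (y 0) →
      (d.background j).radius y + 2 ≤ R j ((d.background j).time y))
    (h11 : ∀ τ' : ℝ, d.τ₀ < τ' → closure (d.flatChart '' {y | τ' ≤ y.1 0}) ⊆
      d.flatChart '' {y | τ' ≤ y.1 0} ∪
        ⋃ j, d.chart j '' {x | τ' ≤ x.1 0 ∧ (d.background j).radius x.1 = d.excision j (x.1 0)})
    (τ₁ : ℝ) (hτ₁ : d.τ₀ < τ₁) :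
    (closure (certifiedLate d R τ₁) ∩ O) \ certifiedLate d R τ₁ ⊆
      certifiedSlab d R τ₁ ∪ ⋃ j, d.chart j '' {x | (d.τ₀ ≤ (d.background j).time x.1 ∨ d.τ₀ ≤ x.1 0) ∧
        R₀ ≤ (d.background j).radius x.1 ∧
        (d.background j).radius x.1 ≤ R j ((d.background j).time x.1) ∧
        (d.background j).time x.1 ≤ τ₁} := by
  rintro z ⟨⟨hzcl, hzO⟩, hzF⟩
  -- the closure of the finite union splits
  have hsplit : z ∈ closure (d.flatChart '' (Minkowski.backgroundOn d.flatDomain).lateRegion τ₁) ∪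
      ⋃ i, closure (d.chart i '' {x | τ₁ < (d.background i).time x.1 ∧
        (d.background i).radius x.1 ≤ R i ((d.background i).time x.1)}) := by
    have h := hzcl
    rw [certifiedLate, closure_union, closure_iUnion_of_finite] at h
    exact h
  rcases hsplit with hz0 | hzU
  · -- flat part: SEAMED (11) at `τ' = τ₁`
    have hsub : d.flatChart '' (Minkowski.backgroundOn d.flatDomain).lateRegion τ₁ ⊆
        d.flatChart '' {y | τ₁ ≤ y.1 0} := by
      rintro _ ⟨y, hy, rfl⟩
      exact ⟨y, le_of_lt (show τ₁ < y.1 0 from hy), rfl⟩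
    rcases h11 τ₁ hτ₁ (closure_mono hsub hz0) with ⟨y, hy, rfl⟩ | hwall
    · -- a flat point with `y⁰ ≥ τ₁`
      rcases (show τ₁ ≤ y.1 0 from hy).eq_or_lt with heq | hlt
      · exact Or.inl (Or.inl ⟨y, heq.symm, rfl⟩)
      · exact (hzF (Or.inl ⟨y, hlt, rfl⟩)).elim
    · -- a flat-tube wall point `Ψⱼ x`, `x⁰ ≥ τ₁`, `rⱼ x = ρⱼ(x⁰)`
      obtain ⟨j, hj⟩ := mem_iUnion.mp hwall
      obtain ⟨x, ⟨hx0, hxr⟩, rfl⟩ := hj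
      have hx0 : τ₁ ≤ x.1 0 := hx0
      have hxr : (d.background j).radius x.1 = d.excision j (x.1 0) := hxr
      have hτ₀x : d.τ₀ ≤ x.1 0 := by linarith
      have hR₀ : R₀ ≤ (d.background j).radius x.1 := by
        rw [hxr]
        exact (h1 j).2 _
      have h8x : (d.background j).radius x.1 + 2 ≤ R j ((d.background j).time x.1) :=
        h8 j x.1 hτ₀x hxr.le
      have hrR : (d.background j).radius x.1 ≤ R j ((d.background j).time x.1) := by linarith
      rcases le_or_gt ((d.background j).time x.1) τ₁ with hle | hgt
      · exact Or.inr (mem_iUnion.mpr ⟨j, x, ⟨Or.inr hτ₀x, hR₀, hrR, hle⟩, rfl⟩)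
      · exact (hzF (Or.inr (mem_iUnion.mpr ⟨j, x, ⟨hgt, hrR⟩, rfl⟩))).elim
  · -- hole part: HonestCore (c) with the continuous profile `ϱ := Rᵢ`
    obtain ⟨i, hzi⟩ := mem_iUnion.mp hzU
    have hsub : d.chart i '' {x | τ₁ < (d.background i).time x.1 ∧
        (d.background i).radius x.1 ≤ R i ((d.background i).time x.1)} ⊆
        d.chart i '' {x | τ₁ ≤ (d.background i).time x.1 ∧
          (d.background i).radius x.1 ≤ R i ((d.background i).time x.1)} := by
      rintro _ ⟨x, ⟨hxt, hxr⟩, rfl⟩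
      exact ⟨x, ⟨hxt.le, hxr⟩, rfl⟩
    obtain ⟨x, ⟨hxt, hxr⟩, rfl⟩ := hcl i τ₁ (R i) (h1 i).1 hτ₁ ⟨closure_mono hsub hzi, hzO⟩
    have hxt : τ₁ ≤ (d.background i).time x.1 := hxt
    have hxr : (d.background i).radius x.1 ≤ R i ((d.background i).time x.1) := hxr
    rcases hxt.eq_or_lt with heq | hlt
    · refine Or.inl (Or.inr (mem_iUnion.mpr ⟨i, x, ⟨heq.symm, ?_⟩, rfl⟩))
      show (d.background i).radius x.1 ≤ R i τ₁
      rw [heq]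
      exact hxr
    · exact (hzF (Or.inr (mem_iUnion.mpr ⟨i, x, ⟨hlt, hxr⟩, rfl⟩))).elim

end Summit.FinalStateConjecture.FinalStateConjecture.Cruxes.SeamedChartsExhaust.DRefute



open Set Filter Topology Function TopologicalSpace
open scoped Manifold ContDiff ENNReal Topology
open Literature.Geometry.Lorentzian

namespace Summit.FinalStateConjecture.FinalStateConjecture.Cruxes.SeamedChartsExhaust.DRefute.Check

set_option linter.dupNamespace false

/-- VERBATIM `WideAnchoring.Registered.stub_firstContact`. -/
abbrev stub_firstContact : Prop :=
  ∀ (𝓢 : Spacetime.{0} 4) (O : Set 𝓢.carrier) (d : FinalStateDecomposition 𝓢 O 2)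
    (R : Fin d.N → ℝ → ℝ),
    (∀ y : d.flatDomain, d.τ₀ < y.1 0 →
      𝓢.timeOrientation.IsFutureDirected (mfderiv 𝓘(ℝ, E4) (𝓡 4) d.flatChart y (E4.basisVector 0))) →
    (∀ i, Continuous (R i)) →
    (∀ j (y : E4), d.τ₀ ≤ y 0 → (d.background j).radius y ≤ d.excision j (y 0) →
      (d.background j).radius y + 2 ≤ R j ((d.background j).time y)) →
    ∀ (τ₁ : ℝ) (y : d.flatDomain), d.τ₀ < y.1 0 → y.1 0 ≤ τ₁ →
      d.flatChart y ∈ 𝓢.metric.causalPast 𝓢.timeOrientation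
          (d.flatChart '' (Minkowski.backgroundOn d.flatDomain).timeSlab τ₁) ∨
        ∃ (c : d.flatDomain) (k : Fin d.N), d.τ₀ < c.1 0 ∧ c.1 0 ≤ τ₁ ∧
          (d.background k).radius c.1 ≤ R k ((d.background k).time c.1) ∧
          d.flatChart y ∈ 𝓢.metric.causalPast 𝓢.timeOrientation {d.flatChart c}

/-- VERBATIM `WideAnchoring.Registered.stub_rim`. -/
abbrev stub_rim : Prop :=
  ∀ (𝓢 : Spacetime.{0} 4) (O : Set 𝓢.carrier) (d : FinalStateDecomposition 𝓢 O 2)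
    (R : Fin d.N → ℝ → ℝ) (R₀ : ℝ),
    (∀ i (τ' : ℝ) (ϱ : ℝ → ℝ), Continuous ϱ → d.τ₀ < τ' →
      closure (d.chart i '' {x | τ' ≤ (d.background i).time x.1 ∧
        (d.background i).radius x.1 ≤ ϱ ((d.background i).time x.1)}) ∩ O ⊆
      d.chart i '' {x | τ' ≤ (d.background i).time x.1 ∧
        (d.background i).radius x.1 ≤ ϱ ((d.background i).time x.1)}) →
    (∀ i, Continuous (R i) ∧ ∀ s, R₀ ≤ d.excision i s) →
    (∀ j (y : E4), d.τ₀ ≤ y 0 → (d.background j).radius y ≤ d.excision j (y 0) →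
      (d.background j).radius y + 2 ≤ R j ((d.background j).time y)) →
    (∀ τ' : ℝ, d.τ₀ < τ' → closure (d.flatChart '' {y | τ' ≤ y.1 0}) ⊆
      d.flatChart '' {y | τ' ≤ y.1 0} ∪
        ⋃ j, d.chart j '' {x | τ' ≤ x.1 0 ∧ (d.background j).radius x.1 = d.excision j (x.1 0)}) →
    ∀ (τ₁ : ℝ), d.τ₀ < τ₁ →
      (closure (certifiedLate d R τ₁) ∩ O) \ certifiedLate d R τ₁ ⊆
        certifiedSlab d R τ₁ ∪ ⋃ j, d.chart j '' {x | (d.τ₀ ≤ (d.background j).time x.1 ∨ d.τ₀ ≤ x.1 0) ∧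
          R₀ ≤ (d.background j).radius x.1 ∧
          (d.background j).radius x.1 ≤ R j ((d.background j).time x.1) ∧
          (d.background j).time x.1 ≤ τ₁}

end Summit.FinalStateConjecture.FinalStateConjecture.Cruxes.SeamedChartsExhaust.DRefute.Check
open Summit.FinalStateConjecture.FinalStateConjecture.Cruxes.SeamedChartsExhaust in
/-- The candidate proof has EXACTLY the registered type of `stub_firstContact`. -/
example : DRefute.Check.stub_firstContact := DRefute.stub_firstContact

open Summit.FinalStateConjecture.FinalStateConjecture.Cruxes.SeamedChartsExhaust in
/-- The candidate proof has EXACTLY the registered type of `stub_rim`. -/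
example : DRefute.Check.stub_rim := DRefute.stub_rim

end
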